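import Mathlib
import Literature.Analysis.FluidPDE.SuitableWeak
import Literature.Analysis.FluidPDE.WeakSolution
import Literature.Analysis.FluidPDE.Seregin2023.TypeIIEulerZoom
import Literature.Analysis.FunctionSpaces.FlatTorusProofs

/-!
# The crux `EulerZoomLiouville.PowerGaugeEulerLiouville` (stmt-NavierStokesRegularity-19832) — the SPATIALLY
# LATTICE-PERIODIC stratum is EMPTY (kinematic: the `A`-gauge alone)

Helper for stmt-NavierStokesRegularity-19832 (`--supports`); theorems only, no definitions, no named-fact
hypotheses; closes no item; Navier–Stokes regularity is NOT proved here (leafhand seat of the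
EulerZoomLiouville route, LAND-ONLY).  Honest label: a DECORATIVE stratum of the crux — no Euler dynamics is
used, only the growth `∫_{B(a)}|u(τ)|² ≤ c a^{1−2ρ}` permitted by the `A`-gauge against the volume growth
`|B(a)| ~ a³` of a periodic slice; recorded so that a lead may add the binder
`¬ (∀ t < 0, Torus.IsLatticePeriodic (u t))` to `stub_nonSelfSimilarRest` BY NAME if wanted.

* `volume_ball_mul_setLIntegral_unitCube_le` — **cell tiling, measurability-free**: for a `ℤ³`-periodic
  `g : ℝ³ → [0,∞]` and every `R`, `|B(0,R−2)| · ∫⁻_{[0,1)³} g ≤ ∫⁻_{B(0,R+3)} g` (the cells `k + [0,1)³`,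
  `‖k‖ ≤ R`, are pairwise disjoint, lie in `B(0,R+3)`, cover `B(0,R−2)`, and each carries `∫⁻_{[0,1)³} g`).
* `lintegral_eq_zero_of_isLatticePeriodic_of_setLIntegral_unitCube` — a periodic `g` with `∫⁻_{[0,1)³} g = 0`
  has `∫⁻_{ℝ³} g = 0` (countable union of cells).
* `powerGaugeEulerLiouville_onLatticePeriodic` — **the crux VERBATIM plus the binder «every slice is
  `ℤ³`-periodic» holds for every `ρ > 0`**: Step 1 (the `A`-gauge is the scaled local energy bound
  `Seregin2023.HasScaledLocalEnergyBound (1−2ρ) c u`) and Step 3 (Tonelli on the slab) are VERBATIM those of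
  the landed rung `PowerGaugeEulerLiouville.powerGaugeEulerLiouville_largeRho`; Step 2 is the tiling bound:
  `|B(0,1)|(a−5)³ · ∫⁻_{[0,1)³}|u(τ)|² ≤ c a^{1−2ρ} ≤ c a` for all large `a` forces `∫⁻_{[0,1)³}|u(τ)|² = 0`.

[cite: Seregin2023, §3 p. 10 (the `A`-gauge of the class)]; [cite: Grafakos2014, §3.1.1]
-/

noncomputable section

set_option linter.dupNamespace false

open MeasureTheory Set Filter Topology Metric Function
open scoped ENNReal NNReal
open Literature.Analysis Literature.Analysis.FluidPDE Literature.Analysis.FunctionSpaces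

namespace Summit.NavierStokesRegularity.NavierStokesRegularity.Theorems.PowerGaugeEulerLiouville.LatticePeriodic

/-! ## §1 Cell tiling (no measurability) -/

/-- `latticeVec (-k) = -latticeVec k`. [folklore] -/
theorem latticeVec_neg (k : Fin 3 → ℤ) : Torus.latticeVec (-k) = -Torus.latticeVec k := by
  have h : Torus.latticeVec (-k) + Torus.latticeVec k = 0 := by
    rw [← Torus.latticeVec_add, neg_add_cancel, Torus.latticeVec_zero]
  exact eq_neg_of_add_eq_zero_left h

/-- `latticeVec` is injective. [folklore] -/
theorem latticeVec_injective : Function.Injective (Torus.latticeVec : (Fin 3 → ℤ) → EuclideanSpace ℝ (Fin 3)) := by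
  intro k l h
  funext i
  have := congr_arg (fun v : EuclideanSpace ℝ (Fin 3) => v i) h
  simp only [Torus.latticeVec_apply] at this
  exact_mod_cast this

/-- The translated cell `k + [0,1)³` carries the cell integral of a `ℤ³`-periodic `g` (no measurability of `g`
needed: translation is a measurable embedding preserving Lebesgue measure). [cite: Grafakos2014, §3.1.1] -/
theorem setLIntegral_cell_eq {g : EuclideanSpace ℝ (Fin 3) → ℝ≥0∞} (hg : Torus.IsLatticePeriodic g)
    (k : Fin 3 → ℤ) :
    ∫⁻ y in (fun y => y - Torus.latticeVec k) ⁻¹' Torus.unitCube (Fin 3), g y =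
      ∫⁻ z in Torus.unitCube (Fin 3), g z := by
  have hfun : (fun y => g y) = fun y => (fun w => g (w + Torus.latticeVec k)) (y - Torus.latticeVec k) := by
    funext y; simp only [sub_add_cancel]
  have h1 := (measurePreserving_sub_right (volume : Measure (EuclideanSpace ℝ (Fin 3)))
    (Torus.latticeVec k)).setLIntegral_comp_preimage_emb
    (MeasurableEquiv.subRight (Torus.latticeVec k)).measurableEmbedding
    (fun w => g (w + Torus.latticeVec k)) (Torus.unitCube (Fin 3))
  have h2 : (fun w => g (w + Torus.latticeVec k)) = g :=
    funext fun w => Torus.IsLatticePeriodic.add_latticeVec_holds hg w k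
  calc ∫⁻ y in (fun y => y - Torus.latticeVec k) ⁻¹' Torus.unitCube (Fin 3), g y
      = ∫⁻ y in (fun y => y - Torus.latticeVec k) ⁻¹' Torus.unitCube (Fin 3),
          (fun w => g (w + Torus.latticeVec k)) (y - Torus.latticeVec k) := by
        simp only [sub_add_cancel]
    _ = ∫⁻ z in Torus.unitCube (Fin 3), (fun w => g (w + Torus.latticeVec k)) z := h1
    _ = ∫⁻ z in Torus.unitCube (Fin 3), g z := by rw [h2]

/-- **Cell tiling bound (measurability-free):** for a `ℤ³`-periodic `g : ℝ³ → [0,∞]` and any `R`,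
`|B(0,R−2)| · ∫⁻_{[0,1)³} g ≤ ∫⁻_{B(0,R+3)} g`. [cite: Grafakos2014, §3.1.1] -/
theorem volume_ball_mul_setLIntegral_unitCube_le {g : EuclideanSpace ℝ (Fin 3) → ℝ≥0∞}
    (hg : Torus.IsLatticePeriodic g) (R : ℝ) :
    volume (ball (0 : EuclideanSpace ℝ (Fin 3)) (R - 2)) * ∫⁻ z in Torus.unitCube (Fin 3), g z ≤
      ∫⁻ y in ball (0 : EuclideanSpace ℝ (Fin 3)) (R + 3), g y := by
  set Q := Torus.unitCube (Fin 3) with hQ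
  set cell : (Fin 3 → ℤ) → Set (EuclideanSpace ℝ (Fin 3)) :=
    fun k => (fun y => y - Torus.latticeVec k) ⁻¹' Q with hcell
  set K : Set (Fin 3 → ℤ) := {k | ‖Torus.latticeVec k‖ ≤ R} with hK
  have hcm : ∀ k, MeasurableSet (cell k) := fun k =>
    Torus.measurableSet_unitCube.preimage (measurable_id.sub measurable_const)
  -- points of the unit cell have norm at most `2`
  have hn2 : ∀ z ∈ Q, ‖z‖ ≤ 2 := by
    intro z hz
    rw [hQ, Torus.mem_unitCube] at hz
    have hcoord : ∀ i, ‖z i‖ ^ 2 ≤ 1 := by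
      intro i
      have h0 := (hz i).1
      have h1 := (hz i).2
      rw [Real.norm_eq_abs, abs_of_nonneg h0]
      nlinarith
    have hsum : ∑ i, ‖z i‖ ^ 2 ≤ 4 := by
      rw [Fin.sum_univ_three]
      linarith [hcoord 0, hcoord 1, hcoord 2]
    rw [EuclideanSpace.norm_eq]
    calc Real.sqrt (∑ i, ‖z i‖ ^ 2) ≤ Real.sqrt 4 := Real.sqrt_le_sqrt hsum
      _ = 2 := by
        rw [show (4 : ℝ) = 2 ^ 2 by norm_num, Real.sqrt_sq (by norm_num : (0 : ℝ) ≤ 2)]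
  -- volume of a cell
  have hvolQ : volume Q = 1 := by
    have hmp := Torus.measurePreserving_proj_unitCube_holds (d := Fin 3)
    have h := hmp.measure_preimage (MeasurableSet.univ : MeasurableSet
      (univ : Set (UnitAddTorus (Fin 3)))).nullMeasurableSet
    rw [preimage_univ, Measure.restrict_apply_univ, measure_univ] at h
    exact h
  have hvol : ∀ k, volume (cell k) = 1 := by
    intro k
    rw [hcell]
    show volume ((fun y => y - Torus.latticeVec k) ⁻¹' Q) = 1
    rw [(measurePreserving_sub_right (volume : Measure (EuclideanSpace ℝ (Fin 3)))
      (Torus.latticeVec k)).measure_preimage Torus.measurableSet_unitCube.nullMeasurableSet, hvolQ]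
  -- pairwise disjointness of the cells
  have hdisj : K.PairwiseDisjoint cell := by
    intro k _ l _ hkl
    rw [Function.onFun, Set.disjoint_left]
    intro y hyk hyl
    apply hkl
    have h1 : Torus.repr (Torus.proj y) = y - Torus.latticeVec k := by
      have e : Torus.proj (y - Torus.latticeVec k) = Torus.proj y := by
        rw [sub_eq_add_neg, ← latticeVec_neg, Torus.proj_add_latticeVec]
      rw [← e]
      exact Torus.repr_proj_of_mem_unitCube_holds hyk
    have h2 : Torus.repr (Torus.proj y) = y - Torus.latticeVec l := by
      have e : Torus.proj (y - Torus.latticeVec l) = Torus.proj y := by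
        rw [sub_eq_add_neg, ← latticeVec_neg, Torus.proj_add_latticeVec]
      rw [← e]
      exact Torus.repr_proj_of_mem_unitCube_holds hyl
    have h3 : Torus.latticeVec k = Torus.latticeVec l := by
      have := h1.symm.trans h2
      exact sub_right_injective this
    exact latticeVec_injective h3
  -- the cells with `‖k‖ ≤ R` lie in `B(0, R+3)` …
  have hsub : (⋃ k ∈ K, cell k) ⊆ ball (0 : EuclideanSpace ℝ (Fin 3)) (R + 3) := by
    intro y hy
    rw [mem_iUnion₂] at hy
    obtain ⟨k, hk, hyk⟩ := hy
    have h1 : ‖y - Torus.latticeVec k‖ ≤ 2 := hn2 _ hyk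
    have h2 : ‖Torus.latticeVec k‖ ≤ R := hk
    rw [mem_ball, dist_zero_right]
    calc ‖y‖ = ‖(y - Torus.latticeVec k) + Torus.latticeVec k‖ := by rw [sub_add_cancel]
      _ ≤ ‖y - Torus.latticeVec k‖ + ‖Torus.latticeVec k‖ := norm_add_le _ _
      _ < R + 3 := by linarith
  -- … and cover `B(0, R-2)`
  have hcov : ball (0 : EuclideanSpace ℝ (Fin 3)) (R - 2) ⊆ ⋃ k ∈ K, cell k := by
    intro y hy
    rw [mem_ball, dist_zero_right] at hy
    obtain ⟨k', hk'⟩ := Torus.exists_repr_proj_eq_add_latticeVec_holds y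
    rw [mem_iUnion₂]
    refine ⟨-k', ?_, ?_⟩
    · show ‖Torus.latticeVec (-k')‖ ≤ R
      rw [latticeVec_neg, norm_neg]
      have h1 : Torus.latticeVec k' = Torus.repr (Torus.proj y) - y := by rw [hk']; abel
      rw [h1]
      calc ‖Torus.repr (Torus.proj y) - y‖ ≤ ‖Torus.repr (Torus.proj y)‖ + ‖y‖ := norm_sub_le _ _
        _ ≤ 2 + (R - 2) := add_le_add (hn2 _ (Torus.repr_mem_unitCube _)) hy.le
        _ = R := by ring
    · show y - Torus.latticeVec (-k') ∈ Q
      rw [latticeVec_neg, sub_neg_eq_add, ← hk']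
      exact Torus.repr_mem_unitCube _
  -- assemble
  have hKc : K.Countable := Set.to_countable K
  have hsum : ∫⁻ y in ⋃ k ∈ K, cell k, g y = ∑' k : K, ∫⁻ z in Q, g z := by
    rw [lintegral_biUnion hKc (fun k _ => hcm k) hdisj]
    congr 1
    funext k
    exact setLIntegral_cell_eq hg k
  have hmeasU : volume (⋃ k ∈ K, cell k) = ∑' k : K, (1 : ℝ≥0∞) := by
    rw [measure_biUnion hKc hdisj (fun k _ => hcm k)]
    congr 1
    funext k
    exact hvol k
  calc volume (ball (0 : EuclideanSpace ℝ (Fin 3)) (R - 2)) * ∫⁻ z in Q, g z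
      ≤ volume (⋃ k ∈ K, cell k) * ∫⁻ z in Q, g z := mul_le_mul' (measure_mono hcov) le_rfl
    _ = ∑' k : K, ∫⁻ z in Q, g z := by
        rw [hmeasU, ← ENNReal.tsum_mul_right]
        simp only [one_mul]
    _ = ∫⁻ y in ⋃ k ∈ K, cell k, g y := hsum.symm
    _ ≤ ∫⁻ y in ball (0 : EuclideanSpace ℝ (Fin 3)) (R + 3), g y := lintegral_mono_set hsub

/-- **A periodic function with null cell integral has null total integral** (measurability-free: the
countably many cells `k + [0,1)³` cover `ℝ³` and each carries the cell integral). [cite: Grafakos2014, §3.1.1] -/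
theorem lintegral_eq_zero_of_isLatticePeriodic_of_setLIntegral_unitCube
    {g : EuclideanSpace ℝ (Fin 3) → ℝ≥0∞} (hg : Torus.IsLatticePeriodic g)
    (h0 : ∫⁻ z in Torus.unitCube (Fin 3), g z = 0) : ∫⁻ y, g y = 0 := by
  set cell : (Fin 3 → ℤ) → Set (EuclideanSpace ℝ (Fin 3)) :=
    fun k => (fun y => y - Torus.latticeVec k) ⁻¹' Torus.unitCube (Fin 3) with hcell
  have hcov : (univ : Set (EuclideanSpace ℝ (Fin 3))) ⊆ ⋃ k, cell k := by
    intro y _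
    obtain ⟨k', hk'⟩ := Torus.exists_repr_proj_eq_add_latticeVec_holds y
    rw [mem_iUnion]
    refine ⟨-k', ?_⟩
    show y - Torus.latticeVec (-k') ∈ Torus.unitCube (Fin 3)
    rw [latticeVec_neg, sub_neg_eq_add, ← hk']
    exact Torus.repr_mem_unitCube _
  refine le_antisymm ?_ zero_le
  calc ∫⁻ y, g y = ∫⁻ y in univ, g y := (setLIntegral_univ _).symm
    _ ≤ ∫⁻ y in ⋃ k, cell k, g y := lintegral_mono_set hcov
    _ ≤ ∑' k, ∫⁻ y in cell k, g y := lintegral_iUnion_le _ _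
    _ = ∑' _k : Fin 3 → ℤ, (0 : ℝ≥0∞) := by
        congr 1; funext k; rw [hcell]; exact (setLIntegral_cell_eq hg k).trans h0
    _ = 0 := tsum_zero

/-! ## §2 The crux on the lattice-periodic stratum -/

/-- **`PowerGaugeEulerLiouville` on the spatially periodic stratum** (all `ρ > 0`): an ancient suitable weak
Euler flow in Seregin's power-gauged class (hypotheses of the crux VERBATIM) all of whose slices are
`ℤ³`-periodic vanishes a.e.  The `A`-gauge gives `∫_{B(a)}|u(τ)|² ≤ c a^{1−2ρ}` for `τ ∈ (−a²,0)`
(`Seregin2023.HasScaledLocalEnergyBound`, as in the landed rung `powerGaugeEulerLiouville_largeRho`); the tiling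
bound `|B(0,a−5)| ∫⁻_{[0,1)³}|u(τ)|² ≤ ∫_{B(a)}|u(τ)|²` then forces `∫⁻_{[0,1)³}|u(τ)|² = 0`, hence every slice
vanishes a.e. and Tonelli on the slab concludes.  Kinematic (no Euler identity used). [cite: Seregin2023, §3 p. 10] -/
theorem powerGaugeEulerLiouville_onLatticePeriodic :
    ∀ ρ : ℝ, 0 < ρ → ∀ (u : ℝ → EuclideanSpace ℝ (Fin 3) → EuclideanSpace ℝ (Fin 3))
      (p : ℝ → EuclideanSpace ℝ (Fin 3) → ℝ)
      (H : ℝ → EuclideanSpace ℝ (Fin 3) → EuclideanSpace ℝ (Fin 3) →L[ℝ] EuclideanSpace ℝ (Fin 3)) (c : ℝ≥0),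
      IsSuitableWeakSolutionOn (slab (EuclideanSpace ℝ (Fin 3)) (Set.Iio 0) isOpen_Iio) 0 0 u p →
      HasWeakSpatialGradientOn (slab (EuclideanSpace ℝ (Fin 3)) (Set.Iio 0) isOpen_Iio) u H →
      (∀ a : ℝ, 0 < a → ENNReal.ofReal (a ^ (2 * ρ)) * cknA a (0 : ℝ × EuclideanSpace ℝ (Fin 3)) u +
        ENNReal.ofReal (a ^ ρ) * cknE a (0 : ℝ × EuclideanSpace ℝ (Fin 3)) H +
        ENNReal.ofReal (a ^ (2 * ρ)) * cknD a (0 : ℝ × EuclideanSpace ℝ (Fin 3)) p ≤ (c : ℝ≥0∞)) →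
      (∀ t < 0, Torus.IsLatticePeriodic (u t)) →
      Function.uncurry u =ᵐ[volume.restrict (Set.Iio (0 : ℝ) ×ˢ (Set.univ : Set (EuclideanSpace ℝ (Fin 3))))] 0 := by
  intro ρ hρ u p H c _hsw hH hc hper
  -- Step 1 (verbatim from the landed rung `powerGaugeEulerLiouville_largeRho`): the `A`-gauge as a scaled bound.
  have hA : Literature.Analysis.FluidPDE.Seregin2023.HasScaledLocalEnergyBound (1 - 2 * ρ) c u := by
    intro a ha s hs
    have h1 := hc a ha
    have hAterm : ENNReal.ofReal (a ^ (2 * ρ)) *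
        Literature.Analysis.FluidPDE.cknA a (0 : ℝ × EuclideanSpace ℝ (Fin 3)) u ≤ (c : ℝ≥0∞) :=
      le_trans (le_trans le_self_add le_self_add) h1
    have hslice : (ENNReal.ofReal a)⁻¹ * ∫⁻ x in ball (0 : EuclideanSpace ℝ (Fin 3)) a, ‖u s x‖ₑ ^ 2 ≤
        Literature.Analysis.FluidPDE.cknA a (0 : ℝ × EuclideanSpace ℝ (Fin 3)) u := by
      unfold Literature.Analysis.FluidPDE.cknA
      have hs' : s ∈ Ioo ((0 : ℝ × EuclideanSpace ℝ (Fin 3)).1 - a ^ 2) (0 : ℝ × EuclideanSpace ℝ (Fin 3)).1 := by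
        simpa using hs
      exact le_iSup₂ (f := fun t (_ : t ∈ Ioo ((0 : ℝ × EuclideanSpace ℝ (Fin 3)).1 - a ^ 2)
          (0 : ℝ × EuclideanSpace ℝ (Fin 3)).1) =>
          (ENNReal.ofReal a)⁻¹ * ∫⁻ x in ball (0 : ℝ × EuclideanSpace ℝ (Fin 3)).2 a, ‖u t x‖ₑ ^ 2) s hs'
    have hB0 : ENNReal.ofReal (a ^ (2 * ρ)) ≠ 0 := by
      rw [ENNReal.ofReal_ne_zero_iff]; exact Real.rpow_pos_of_pos ha _
    have hBtop : ENNReal.ofReal (a ^ (2 * ρ)) ≠ ⊤ := ENNReal.ofReal_ne_top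
    have hA0 : ENNReal.ofReal a ≠ 0 := by rw [ENNReal.ofReal_ne_zero_iff]; exact ha
    have hAtop : ENNReal.ofReal a ≠ ⊤ := ENNReal.ofReal_ne_top
    have h2 : ENNReal.ofReal (a ^ (2 * ρ)) *
        ((ENNReal.ofReal a)⁻¹ * ∫⁻ x in ball (0 : EuclideanSpace ℝ (Fin 3)) a, ‖u s x‖ₑ ^ 2) ≤ (c : ℝ≥0∞) :=
      le_trans (mul_le_mul_right hslice _) hAterm
    have h3 : ∫⁻ x in ball (0 : EuclideanSpace ℝ (Fin 3)) a, ‖u s x‖ₑ ^ 2 ≤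
        ENNReal.ofReal a * (ENNReal.ofReal (a ^ (2 * ρ)))⁻¹ * (c : ℝ≥0∞) := by
      have key : ∫⁻ x in ball (0 : EuclideanSpace ℝ (Fin 3)) a, ‖u s x‖ₑ ^ 2 =
          ENNReal.ofReal a * (ENNReal.ofReal (a ^ (2 * ρ)))⁻¹ *
            (ENNReal.ofReal (a ^ (2 * ρ)) *
              ((ENNReal.ofReal a)⁻¹ * ∫⁻ x in ball (0 : EuclideanSpace ℝ (Fin 3)) a, ‖u s x‖ₑ ^ 2)) := by
        rw [← mul_assoc, mul_assoc (ENNReal.ofReal a), ENNReal.inv_mul_cancel hB0 hBtop, mul_one,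
          ← mul_assoc, ENNReal.mul_inv_cancel hA0 hAtop, one_mul]
      rw [key]
      exact mul_le_mul_right h2 _
    refine le_trans h3 (le_of_eq ?_)
    rw [← ENNReal.ofReal_inv_of_pos (Real.rpow_pos_of_pos ha _), ← ENNReal.ofReal_mul ha.le,
      ENNReal.coe_nnreal_eq, ← ENNReal.ofReal_mul (by positivity)]
    congr 1
    rw [mul_comm, Real.rpow_sub ha, Real.rpow_one, div_eq_mul_inv]
  -- Step 2 (new): every periodic slice has zero energy.
  have hv1 : 0 < volume.real (ball (0 : EuclideanSpace ℝ (Fin 3)) 1) := by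
    rw [measureReal_def]
    exact ENNReal.toReal_pos (measure_ball_pos volume _ one_pos).ne' measure_ball_lt_top.ne
  have hslice0 : ∀ s : ℝ, s < 0 → ∫⁻ y, ‖u s y‖ₑ ^ 2 = 0 := by
    intro s hs
    set g : EuclideanSpace ℝ (Fin 3) → ℝ≥0∞ := fun y => ‖u s y‖ₑ ^ 2 with hgdef
    have hgp : Torus.IsLatticePeriodic g := by
      intro j y
      simp only [hgdef]
      rw [hper s hs j y]
    set μ : ℝ≥0∞ := ∫⁻ z in Torus.unitCube (Fin 3), g z with hμdef
    -- the tiling bound against the gauge, for all large `a`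
    have hkey : ∀ a : ℝ, 5 < a → Real.sqrt (-s) < a →
        ENNReal.ofReal ((a - 5) ^ 3) * volume (ball (0 : EuclideanSpace ℝ (Fin 3)) 1) * μ ≤
          ENNReal.ofReal (c * a ^ (1 - 2 * ρ)) := by
      intro a ha5 has
      have ha : 0 < a := by linarith
      have hs' : s ∈ Ioo (-(a ^ 2)) 0 := by
        refine ⟨?_, hs⟩
        have h1 : Real.sqrt (-s) ^ 2 = -s := Real.sq_sqrt (by linarith)
        have h2 : 0 ≤ Real.sqrt (-s) := Real.sqrt_nonneg _
        nlinarith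
      have h1 := hA a ha s hs'
      have h2 := volume_ball_mul_setLIntegral_unitCube_le hgp (a - 3)
      rw [show a - 3 + 3 = a by ring, show a - 3 - 2 = a - 5 by ring] at h2
      rw [Measure.addHaar_ball_of_pos volume (0 : EuclideanSpace ℝ (Fin 3)) (by linarith : 0 < a - 5),
        finrank_euclideanSpace_fin] at h2
      exact h2.trans h1
    by_contra hne
    -- `μ ≠ 0`
    have hμ0 : μ ≠ 0 := by
      intro hμ
      exact hne (lintegral_eq_zero_of_isLatticePeriodic_of_setLIntegral_unitCube hgp hμ)
    have hvol1 : volume (ball (0 : EuclideanSpace ℝ (Fin 3)) 1) = ENNReal.ofReal (volume.real (ball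
        (0 : EuclideanSpace ℝ (Fin 3)) 1)) := by
      rw [measureReal_def, ENNReal.ofReal_toReal measure_ball_lt_top.ne]
    rcases eq_or_ne μ ⊤ with hμtop | hμtop
    · -- infinite cell energy: the left side is `⊤`
      set a : ℝ := max 6 (Real.sqrt (-s) + 1) with hadef
      have ha5 : 5 < a := by rw [hadef]; exact lt_of_lt_of_le (by norm_num) (le_max_left _ _)
      have has : Real.sqrt (-s) < a := by
        rw [hadef]; exact lt_of_lt_of_le (by linarith) (le_max_right _ _)
      have h1 := hkey a ha5 has
      rw [hμtop, ENNReal.mul_top (by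
        refine mul_ne_zero ?_ (measure_ball_pos volume _ one_pos).ne'
        rw [ENNReal.ofReal_ne_zero_iff]; positivity)] at h1
      exact absurd (top_le_iff.1 h1) ENNReal.ofReal_ne_top
    · -- finite positive cell energy: polynomial growth contradiction
      set m : ℝ := μ.toReal with hmdef
      have hm0 : 0 < m := ENNReal.toReal_pos hμ0 hμtop
      have hμeq : μ = ENNReal.ofReal m := by rw [hmdef, ENNReal.ofReal_toReal hμtop]
      set κ : ℝ := volume.real (ball (0 : EuclideanSpace ℝ (Fin 3)) 1) * m with hκdef
      have hκ0 : 0 < κ := mul_pos hv1 hm0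
      have hreal : ∀ a : ℝ, 5 < a → Real.sqrt (-s) < a → (a - 5) ^ 3 * κ ≤ c * a := by
        intro a ha5 has
        have ha1 : 1 ≤ a := by linarith
        have h1 := hkey a ha5 has
        rw [hvol1, hμeq, ← ENNReal.ofReal_mul (by positivity), ← ENNReal.ofReal_mul (by positivity)]
          at h1
        have h2 : (a - 5) ^ 3 * volume.real (ball (0 : EuclideanSpace ℝ (Fin 3)) 1) * m ≤
            c * a ^ (1 - 2 * ρ) := (ENNReal.ofReal_le_ofReal_iff (by positivity)).1 h1
        have h3 : a ^ (1 - 2 * ρ) ≤ a := by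
          calc a ^ (1 - 2 * ρ) ≤ a ^ (1 : ℝ) :=
                Real.rpow_le_rpow_of_exponent_le ha1 (by linarith)
            _ = a := Real.rpow_one a
        have h4 : (c : ℝ) * a ^ (1 - 2 * ρ) ≤ c * a := mul_le_mul_of_nonneg_left h3 c.coe_nonneg
        calc (a - 5) ^ 3 * κ = (a - 5) ^ 3 * volume.real (ball (0 : EuclideanSpace ℝ (Fin 3)) 1) * m := by
              rw [hκdef]; ring
          _ ≤ c * a := h2.trans h4
      -- for `a ≥ 10`, `(a-5)³ ≥ a³/8`, so `κ a² ≤ 8 c`: impossible for large `a`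
      have hev : ∀ᶠ a : ℝ in atTop, κ * a ^ 2 ≤ 8 * c := by
        filter_upwards [eventually_ge_atTop (10 : ℝ), eventually_gt_atTop (Real.sqrt (-s))] with a ha10 has
        have h1 := hreal a (by linarith) has
        have ha0 : 0 < a := by linarith
        have h2 : a ^ 3 / 8 ≤ (a - 5) ^ 3 := by
          have h6 : a / 2 ≤ a - 5 := by linarith
          have h7 : (a / 2) ^ 3 ≤ (a - 5) ^ 3 := pow_le_pow_left₀ (by positivity) h6 3
          have h8 : (a / 2) ^ 3 = a ^ 3 / 8 := by ring
          linarith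
        have h3 : a ^ 3 / 8 * κ ≤ c * a := (mul_le_mul_of_nonneg_right h2 hκ0.le).trans h1
        have h4 : a ^ 2 * κ ≤ 8 * c := by
          have : a ^ 3 / 8 * κ = a * (a ^ 2 * κ / 8) := by ring
          rw [this] at h3
          have h5 : a ^ 2 * κ / 8 ≤ c := le_of_mul_le_mul_left (by linarith) ha0
          linarith
        linarith
      have hgt : ∀ᶠ a : ℝ in atTop, 8 * (c : ℝ) < κ * a ^ 2 := by
        have ht : Tendsto (fun a : ℝ => κ * a ^ 2) atTop atTop :=
          (tendsto_pow_atTop two_ne_zero).const_mul_atTop hκ0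
        exact ht.eventually_gt_atTop _
      obtain ⟨a, ha1, ha2⟩ := (hev.and hgt).exists
      exact absurd ha1 (not_le.2 ha2)
  -- Step 3 (verbatim from the landed rung): Tonelli on the slab.
  have hmeas : AEStronglyMeasurable (Function.uncurry u)
      (volume.restrict (Set.Iio (0 : ℝ) ×ˢ (Set.univ : Set (EuclideanSpace ℝ (Fin 3))))) := by
    have := hH.locallyIntegrableOn.aestronglyMeasurable
    simpa [Literature.Analysis.FluidPDE.slab] using this
  have hint : ∫⁻ z in Set.Iio (0 : ℝ) ×ˢ (Set.univ : Set (EuclideanSpace ℝ (Fin 3))),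
      ‖Function.uncurry u z‖ₑ ^ 2 = 0 := by
    rw [Measure.volume_eq_prod, ← Measure.prod_restrict, Measure.restrict_univ,
      lintegral_prod _ (by
        have hm := hmeas.aemeasurable.enorm.pow_const 2
        rw [Measure.volume_eq_prod, ← Measure.prod_restrict, Measure.restrict_univ] at hm
        exact hm)]
    have hzero : (fun s : ℝ => ∫⁻ y, ‖Function.uncurry u (s, y)‖ₑ ^ 2) =ᵐ[volume.restrict (Iio 0)] 0 := by
      rw [EventuallyEq, ae_restrict_iff' measurableSet_Iio]
      exact ae_of_all _ (fun s hs => by simpa [Function.uncurry] using hslice0 s hs)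
    rw [lintegral_congr_ae hzero]; simp
  have hae : (fun z => ‖Function.uncurry u z‖ₑ ^ 2) =ᵐ[volume.restrict
      (Set.Iio (0 : ℝ) ×ˢ (Set.univ : Set (EuclideanSpace ℝ (Fin 3))))] 0 :=
    (lintegral_eq_zero_iff' (hmeas.aemeasurable.enorm.pow_const 2)).1 hint
  filter_upwards [hae] with z hz
  have hz' : ‖Function.uncurry u z‖ₑ ^ 2 = 0 := hz
  rwa [pow_eq_zero_iff two_ne_zero, enorm_eq_zero] at hz'

end Summit.NavierStokesRegularity.NavierStokesRegularity.Theorems.PowerGaugeEulerLiouville.LatticePeriodic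

end
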